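import Literature.AlgebraicGeometry.Surfaces.VanGeemenSarti2007ExistsNikulinK3PicardNine
import Literature.AlgebraicGeometry.Surfaces.K3MarkingProofs
import HarnessLib

/-!
# The resolved Nikulin quotient (van Geemen–Sarti 2007 §1.4–1.8, §2.4–2.5) — proofs, part 1:
# rigidity of integral markings ("through any marking" is "through one marking")

Family `hodge`, layer `Literature/AlgebraicGeometry/Surfaces`. Companion (proof file) of
`VanGeemenSarti2007ExistsNikulinK3PicardNine.lean`, working towards the named fact
`VanGeemenSarti2007_nikulinQuotient` (the cohomological package of `Y = X̃/ι̃`, the minimal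
resolution of the Nikulin quotient `X/ι`: van Geemen–Sarti, Math. Z. 255 (2007), §1.4–1.6,
Prop. 1.8, §2.4 and the proof of Prop. 2.5). Everything here is PROVED; no named fact is
introduced (D-0026).

## What this part proves

Clauses (b) (`N_i ∪ N_j = −2δ_ij p'`) and (g) (`β_*π^*x ∪ β_*π^*y = 2(x ∪ y)`) of the fact are
stated "through ANY marking": for every `ℂ`-linear `η₀ : H²(Y(ℂ); ℂ) ≃ Λ_ℂ` under which the
integral classes are exactly `ℤ²² ⊂ Λ_ℂ = ℂ²²` and every `p' ∈ H⁴(Y(ℂ); ℂ)` with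
`a ∪ b = (η₀a . η₀b)_Λ p'` (`Λ = Λ_{K3} = E₈(−1)^{⊕2} ⊕ U^{⊕3}`, the tree's `k3Form`), whereas the
printed computation (§1.5 "`N_i² = −2`, `N_iN_j = 0`"; proof of Prop. 2.5
"`(β_*π^*x)(β_*π^*y) = 2xy`") is an identity of intersection NUMBERS, i.e. holds for the one class
`p' = [pt]` dual to the fundamental class. The bridge is the following rigidity statement, proved
here in complete generality (any `ℂ`-vector spaces `H`, `H₄`, any "integrality" predicate on `H`,
any pairing `H × H → H₄`):

* `marking_generator_eq` — **two integral `Λ_{K3}`-markings name the same class `p`**: if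
  `(η, p)` and `(η', p')` both satisfy "integral `↔` image in `ℤ²²`" and
  "`a ∪ b = (ηa.ηb) p`", then `p = p'`. Proof: `θ := η' ∘ η⁻¹` restricts to a group automorphism of
  `ℤ²²`; evaluating on a hyperbolic pair `e, f ∈ U` (`(e.f) = 1`) gives `p = m p'`, `p' = m' p`
  with `m, m' ∈ ℤ`, so `p = p' = 0` or `m = ±1`; and `m = −1` would make `θ` an isometry
  `Λ_{K3} ≅ Λ_{K3}(−1)`, impossible as the index `τ(Λ_{K3}) = −16` (the tree's
  `signature_toBilin'_k3Gram`, Huybrechts Ch. 14 §0.3 (vi)) is not `0` (`τ(Λ(−1)) = −τ(Λ)`,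
  `signature_neg`, `signature_eq_of_equivalent`; Milnor–Husemoller II §2).
* `k3Form_marking_eq` — consequently, when the pairing is non-zero, `θ` is an ISOMETRY of `Λ_ℂ`:
  `(ηa.ηb) = (η'a.η'b)` for all `a, b` (so `θ|_{ℤ²²} ∈ O(Λ_{K3})`: Huybrechts Ch. 1 §3.3, markings
  differ by `O(Λ)`).
* On the summit carriers (`complexBetti`, `cupProduct`, `IsIntegralClass`):
  `marking_generator_eq_of_cupProduct`, and the two transfer lemmas in the exact binder shape of
  the fact — `VanGeemenSarti2007_nikulinQuotient.nodal_cup_of_one_marking` (clause (b) for all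
  markings of `Y` from clause (b) in one marking) and
  `VanGeemenSarti2007_nikulinQuotient.double_cup_of_one_marking` (clause (g) for all pairs of
  markings of `X`, `Y` from one pair).

In particular the "any marking" rendering of (b), (g) is NOT stronger than the printed
single-orientation statements (an anti-isometric integral marking, under which (b) would read
`N_i² = +2[pt]`, does not exist) — the faithfulness point recorded in the fact's audit.

## What is NOT here (the census of `VanGeemenSarti2007_nikulinQuotient`)

The construction of `Y = X̃/ι̃` as a `ℂ`-scheme and `IsK3Surface Y` (finite quotients of
projective surfaces and their projectivity, blow-ups of the eight fixed points — whose count is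
the unproved named fact `Nikulin_involution_eight_fixedPoints` —, smoothness of `X̃/ι̃`,
`H¹(𝒪_Y) = 0`, the descended nowhere-vanishing holomorphic `2`-form), the classes of the nodal
curves and their intersection numbers as cup products, `β_*π^*` on `H²(–(ℂ); ℂ)` with
`H²(X̃) = β^*H²(X) ⊕ ⊕ℂE_i` and `π^*b ∪ π^*c = 2(b ∪ c)`, the correspondence class of
`(β, π)(X̃)`, and "ample ⇒ Kähler" with Hartshorne II.7.10 (b): none of these has a carrier-level
theory in the tree yet (see the seat notes).

## References

* [VanGeemenSarti2007] B. van Geemen, A. Sarti, Nikulin involutions on K3 surfaces, Math. Z. 255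
  (2007) 731–753 = arXiv:math/0602015, §1.4–1.6, Prop. 1.8, §2.4, Prop. 2.5 (and its proof).
* [Huybrechts2016K3] D. Huybrechts, Lectures on K3 Surfaces, CUP 2016, Ch. 1 §3.3 and Prop. 3.5
  (markings, `Λ = E₈(−1)^{⊕2} ⊕ U^{⊕3}`), Ch. 14 §0.3 (vi) (`τ(Λ) = −16`).
* [MilnorHusemoller1973] J. Milnor, D. Husemoller, Symmetric Bilinear Forms, Springer 1973, II §2
  (the signature is an isometry invariant; `τ(−Q) = −τ(Q)`).
-/

noncomputable section

open CategoryTheory Module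
open LinearMap (BilinForm)
open Literature.AlgebraicTopology.SingularHomology
open Literature.AlgebraicGeometry.HodgeTheory

universe u v

namespace Literature.AlgebraicGeometry.Surfaces

/-! ### Integer vectors of `Λ_{K3}` inside `Λ_ℂ` -/

section IntVectors

/-- On integer vectors the `ℂ`-bilinear K3 form `k3Form` is (the cast of) the integral lattice form
`⟨k3Gram⟩` of `Λ_{K3} = E₈(−1)^{⊕2} ⊕ U^{⊕3}`. [cite: Huybrechts2016K3, Ch. 1 §3.3] -/
theorem k3Form_intCast_toBilin' (v w : K3Index → ℤ) :
    k3Form (fun i => (v i : ℂ)) (fun i => (w i : ℂ)) = ((Matrix.toBilin' k3Gram v w : ℤ) : ℂ) := by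
  rw [k3Form_intCast, Matrix.toBilin'_apply]

/-- `ℤ²² → ℂ²²` is injective. [folklore] -/
theorem intCast_vec_injective {v w : K3Index → ℤ}
    (h : (fun i => (v i : ℂ)) = fun i => (w i : ℂ)) : v = w := by
  funext i
  exact_mod_cast congrFun h i

/-- `ℤ²² → ℂ²²` is additive. [folklore] -/
theorem intCast_vec_add (v w : K3Index → ℤ) :
    (fun i => ((v + w) i : ℂ)) = (fun i => (v i : ℂ)) + fun i => (w i : ℂ) := by
  funext i
  simp only [Pi.add_apply, Int.cast_add]

/-- The standard hyperbolic pair `e, f` of the first copy of `U` in `Λ_{K3}` has `(e.f) = 1`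
(so the lattice form represents `1` on `ℤ²²`). [cite: Huybrechts2016K3, Ch. 1 §3.3] -/
theorem toBilin'_k3Gram_hyperbolicPair :
    Matrix.toBilin' k3Gram (Pi.single (Sum.inr (Sum.inl 0)) 1) (Pi.single (Sum.inr (Sum.inl 1)) 1) = 1 := by
  rw [Matrix.toBilin'_single]
  rfl

end IntVectors

/-! ### Rigidity of integral `Λ_{K3}`-markings -/

section Rigidity

variable {H : Type u} [AddCommGroup H] [Module ℂ H] {H₄ : Type v} [AddCommGroup H₄] [Module ℂ H₄]

/-- **The change of marking `θ = η' ∘ η⁻¹` preserves `ℤ²²`** when both markings identify the same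
integral classes with `ℤ²²`: every integer vector `v` is sent to an integer vector.
[cite: Huybrechts2016K3, Ch. 1 §3.3] -/
theorem exists_marking_change_intCast (IsInt : H → Prop) (η η' : H ≃ₗ[ℂ] (K3Index → ℂ))
    (hη : ∀ c, IsInt c ↔ ∃ v : K3Index → ℤ, η c = fun i => (v i : ℂ))
    (hη' : ∀ c, IsInt c ↔ ∃ v : K3Index → ℤ, η' c = fun i => (v i : ℂ)) (v : K3Index → ℤ) :
    ∃ w : K3Index → ℤ, η' (η.symm fun i => (v i : ℂ)) = fun i => (w i : ℂ) :=
  (hη' _).1 ((hη _).2 ⟨v, LinearEquiv.apply_symm_apply η _⟩)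

/-- **Two integral `Λ_{K3}`-markings name the same class `p`.** Let `η, η' : H ≃ Λ_ℂ` be
`ℂ`-linear, both identifying a given set of "integral" elements of `H` with `ℤ²² ⊂ ℂ²²`, and let
`p, p' ∈ H₄` satisfy `(ηa.ηb)_Λ p = (η'a.η'b)_Λ p'` for all `a, b ∈ H` (as when both equal a pairing
`a ∪ b`). Then `p = p'`. (Markings of a K3 surface differ by `O(Λ_{K3})`, Huybrechts Ch. 1 §3.3;
the point is that an ANTI-isometry `Λ_{K3} ≅ Λ_{K3}(−1)`, which would give `p' = −p`, does not
exist: `τ(Λ_{K3}) = −16 ≠ 0` while `τ(Λ(−1)) = −τ(Λ)` and the index is an isometry invariant,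
Milnor–Husemoller II §2.) [cite: Huybrechts2016K3, Ch. 1 §3.3 and Ch. 14 §0.3 (vi)]
[cite: MilnorHusemoller1973, II §2] -/
theorem marking_generator_eq (IsInt : H → Prop) (η η' : H ≃ₗ[ℂ] (K3Index → ℂ)) (p p' : H₄)
    (hη : ∀ c, IsInt c ↔ ∃ v : K3Index → ℤ, η c = fun i => (v i : ℂ))
    (hη' : ∀ c, IsInt c ↔ ∃ v : K3Index → ℤ, η' c = fun i => (v i : ℂ))
    (hpp' : ∀ a b : H, k3Form (η a) (η b) • p = k3Form (η' a) (η' b) • p') :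
    p = p' := by
  classical
  set B : BilinForm ℤ (K3Index → ℤ) := Matrix.toBilin' k3Gram with hBdef
  -- the change of marking on integer vectors, in both directions
  choose θ hθ using exists_marking_change_intCast IsInt η η' hη hη' (H := H)
  choose θ' hθ' using exists_marking_change_intCast IsInt η' η hη' hη (H := H)
  -- the key identity `(v.w) p = (θv.θw) p'` on integer vectors, and its mirror image
  have key : ∀ v w : K3Index → ℤ, ((B v w : ℤ) : ℂ) • p = ((B (θ v) (θ w) : ℤ) : ℂ) • p' := by
    intro v w
    have h := hpp' (η.symm fun i => (v i : ℂ)) (η.symm fun i => (w i : ℂ))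
    rwa [LinearEquiv.apply_symm_apply, LinearEquiv.apply_symm_apply, hθ v, hθ w,
      k3Form_intCast_toBilin', k3Form_intCast_toBilin'] at h
  have key' : ∀ v w : K3Index → ℤ, ((B v w : ℤ) : ℂ) • p' = ((B (θ' v) (θ' w) : ℤ) : ℂ) • p := by
    intro v w
    have h := (hpp' (η'.symm fun i => (v i : ℂ)) (η'.symm fun i => (w i : ℂ))).symm
    rwa [LinearEquiv.apply_symm_apply, LinearEquiv.apply_symm_apply, hθ' v, hθ' w,
      k3Form_intCast_toBilin', k3Form_intCast_toBilin'] at h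
  -- evaluate on the hyperbolic pair: `p = m p'`, `p' = m' p`
  set e : K3Index → ℤ := Pi.single (Sum.inr (Sum.inl 0)) 1 with he
  set f : K3Index → ℤ := Pi.single (Sum.inr (Sum.inl 1)) 1 with hf
  have hef : B e f = 1 := toBilin'_k3Gram_hyperbolicPair
  have hm : p = ((B (θ e) (θ f) : ℤ) : ℂ) • p' := by simpa [hef] using key e f
  have hm' : p' = ((B (θ' e) (θ' f) : ℤ) : ℂ) • p := by simpa [hef] using key' e f
  set m : ℤ := B (θ e) (θ f) with hmdef
  set m' : ℤ := B (θ' e) (θ' f) with hm'def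
  by_cases hp0 : p = 0
  · rw [hm', hp0, smul_zero]
  -- `m * m' = 1`, so `m = ±1`
  have hmm' : m * m' = 1 := by
    have h1 : ((m * m' : ℤ) : ℂ) • p = (1 : ℂ) • p := by
      rw [Int.cast_mul, mul_smul, ← hm', ← hm, one_smul]
    exact_mod_cast smul_left_injective ℂ hp0 h1
  rcases Int.eq_one_or_neg_one_of_mul_eq_one hmm' with h1 | h1
  · rw [hm, h1, Int.cast_one, one_smul]
  -- `m = -1`: `θ` would be an isometry `Λ ≅ Λ(−1)`, contradicting `τ(Λ) = −16 ≠ 0`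
  exfalso
  have hpneg : p' = -p := by
    have : p = -p' := by rw [hm, h1, Int.cast_neg, Int.cast_one, neg_smul, one_smul]
    rw [this, neg_neg]
  have hanti : ∀ v w : K3Index → ℤ, B (θ v) (θ w) = -B v w := by
    intro v w
    have h := key v w
    rw [hpneg, smul_neg, ← neg_smul, ← Int.cast_neg] at h
    have h' : ((B v w : ℤ) : ℂ) = ((-B (θ v) (θ w) : ℤ) : ℂ) := smul_left_injective ℂ hp0 h
    have h'' : B v w = -B (θ v) (θ w) := by exact_mod_cast h'
    rw [h'', neg_neg]
  -- `θ` is a group automorphism of `ℤ²²` with inverse `θ'`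
  have hadd : ∀ v w, θ (v + w) = θ v + θ w := by
    intro v w
    apply intCast_vec_injective
    rw [← hθ, intCast_vec_add, map_add, map_add, hθ, hθ, ← intCast_vec_add]
  have hleft : ∀ v, θ' (θ v) = v := by
    intro v
    apply intCast_vec_injective
    rw [← hθ', ← hθ, LinearEquiv.symm_apply_apply, LinearEquiv.apply_symm_apply]
  have hright : ∀ w, θ (θ' w) = w := by
    intro w
    apply intCast_vec_injective
    rw [← hθ, ← hθ', LinearEquiv.symm_apply_apply, LinearEquiv.apply_symm_apply]
  let Θ : (K3Index → ℤ) ≃+ (K3Index → ℤ) :=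
    { toFun := θ, invFun := θ', left_inv := hleft, right_inv := hright,
      map_add' := hadd }
  have hiso : B.Equivalent (-B) :=
    ⟨{ Θ.toIntLinearEquiv with
        map_app' := fun v w => by
          change (-B) (θ v) (θ w) = B v w
          rw [LinearMap.neg_apply, LinearMap.neg_apply, hanti, neg_neg] }⟩
  have hsig := LinearMap.BilinForm.signature_eq_of_equivalent hiso
  rw [LinearMap.BilinForm.signature_neg, hBdef, signature_toBilin'_k3Gram] at hsig
  norm_num at hsig

/-- **The change of marking is an isometry of `Λ_ℂ`**: under the hypotheses of
`marking_generator_eq`, if the pairing is not identically zero (`p ≠ 0`) then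
`(ηa.ηb)_Λ = (η'a.η'b)_Λ` for all `a, b` — `η' ∘ η⁻¹ ∈ O(Λ_ℂ)`, and it preserves `ℤ²²`
(`exists_marking_change_intCast`), so it lies in `O(Λ_{K3})`: "any two markings differ by an
orthogonal transformation of `Λ`". [cite: Huybrechts2016K3, Ch. 1 §3.3] -/
theorem k3Form_marking_eq (IsInt : H → Prop) (η η' : H ≃ₗ[ℂ] (K3Index → ℂ)) (p p' : H₄)
    (hη : ∀ c, IsInt c ↔ ∃ v : K3Index → ℤ, η c = fun i => (v i : ℂ))
    (hη' : ∀ c, IsInt c ↔ ∃ v : K3Index → ℤ, η' c = fun i => (v i : ℂ))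
    (hpp' : ∀ a b : H, k3Form (η a) (η b) • p = k3Form (η' a) (η' b) • p') (hp : p ≠ 0)
    (a b : H) : k3Form (η a) (η b) = k3Form (η' a) (η' b) := by
  have hpp : p = p' := marking_generator_eq IsInt η η' p p' hη hη' hpp'
  have h := hpp' a b
  rw [← hpp] at h
  exact smul_left_injective ℂ hp h

end Rigidity

/-! ### On the summit carriers: one marking suffices in clauses (b) and (g) -/

section Carriers

variable {X Y : Motives.SchemeOver ℂ}

/-- **Integral markings of `H²(Y(ℂ); ℂ)` name the same class of `H⁴(Y(ℂ); ℂ)`**: for two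
`ℂ`-linear `η, η' : H²(Y(ℂ); ℂ) ≃ Λ_ℂ` under each of which the integral classes are exactly
`ℤ²²`, and `p, p'` with `a ∪ b = (ηa.ηb) p = (η'a.η'b) p'` for all `a, b`, one has `p = p'`
(`marking_generator_eq` for the cup product `H² × H² → H⁴`). For a K3 surface this is the
statement that the class `p` of a marking as in `Huybrechts_K3_marking_exists` is intrinsic (the
positive generator of `H⁴(Y, ℤ)`). [cite: Huybrechts2016K3, Ch. 1 §3.3 and Prop. 3.5] -/
theorem marking_generator_eq_of_cupProduct
    (η η' : complexBetti Y (2 * 1) ≃ₗ[ℂ] (K3Index → ℂ)) (p p' : complexBetti Y (2 * 2))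
    (hη : ∀ c : complexBetti Y (2 * 1), IsIntegralClass c ↔ ∃ v : K3Index → ℤ, η c = fun i => (v i : ℂ))
    (hp : ∀ a b : complexBetti Y (2 * 1),
      cupProduct (rfl : 2 * 1 + 2 * 1 = 2 * 2) a b = k3Form (η a) (η b) • p)
    (hη' : ∀ c : complexBetti Y (2 * 1), IsIntegralClass c ↔ ∃ v : K3Index → ℤ, η' c = fun i => (v i : ℂ))
    (hp' : ∀ a b : complexBetti Y (2 * 1),
      cupProduct (rfl : 2 * 1 + 2 * 1 = 2 * 2) a b = k3Form (η' a) (η' b) • p') :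
    p = p' :=
  marking_generator_eq (fun c => IsIntegralClass c) η η' p p' hη hη' fun a b => by rw [← hp, ← hp']

/-- **Clause (b) of `VanGeemenSarti2007_nikulinQuotient` through one marking.** If the nodal
classes `N_1, …, N_8 ∈ H²(Y(ℂ); ℂ)` satisfy `N_i ∪ N_j = −2δ_ij p₁` for ONE integral marking
`(η₁, p₁)` of `Y` (van Geemen–Sarti §1.5: "`N_i² = −2`, `N_iN_j = 0` for `i ≠ j`", an identity of
intersection numbers, i.e. with `p₁ = [pt]`), then they satisfy it through EVERY integral marking
`(η₀, p')`, which is the binder shape of clause (b) of the fact. [cite: VanGeemenSarti2007, §1.5]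
[cite: Huybrechts2016K3, Ch. 1 §3.3] -/
theorem VanGeemenSarti2007_nikulinQuotient.nodal_cup_of_one_marking
    (N : Fin 8 → complexBetti Y (2 * 1))
    (η₁ : complexBetti Y (2 * 1) ≃ₗ[ℂ] (K3Index → ℂ)) (p₁ : complexBetti Y (2 * 2))
    (hη₁ : ∀ c : complexBetti Y (2 * 1), IsIntegralClass c ↔ ∃ v : K3Index → ℤ, η₁ c = fun i => (v i : ℂ))
    (hp₁ : ∀ a b : complexBetti Y (2 * 1),
      cupProduct (rfl : 2 * 1 + 2 * 1 = 2 * 2) a b = k3Form (η₁ a) (η₁ b) • p₁)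
    (hN : ∀ i j, cupProduct (rfl : 2 * 1 + 2 * 1 = 2 * 2) (N i) (N j) =
      (if i = j then (-2 : ℂ) else 0) • p₁) :
    ∀ (η₀ : complexBetti Y (2 * 1) ≃ₗ[ℂ] (K3Index → ℂ)) (p' : complexBetti Y (2 * 2)),
      (∀ c : complexBetti Y (2 * 1), IsIntegralClass c ↔ ∃ v : K3Index → ℤ, η₀ c = fun i => (v i : ℂ)) →
      (∀ a b : complexBetti Y (2 * 1),
        cupProduct (rfl : 2 * 1 + 2 * 1 = 2 * 2) a b = k3Form (η₀ a) (η₀ b) • p') →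
      ∀ i j, cupProduct (rfl : 2 * 1 + 2 * 1 = 2 * 2) (N i) (N j) =
        (if i = j then (-2 : ℂ) else 0) • p' := by
  intro η₀ p' hη₀ hp' i j
  rw [hN, marking_generator_eq_of_cupProduct η₁ η₀ p₁ p' hη₁ hp₁ hη₀ hp']

/-- **Clause (g) of `VanGeemenSarti2007_nikulinQuotient` through one pair of markings.** If
`G x ∪ G y = 2(x ∪ y)` for `x, y ⊥ N_1, …, N_8` holds when read through ONE integral marking
`(φ₁, p₁)` of `X` and ONE integral marking `(η₁, p₁')` of `Y` (proof of van Geemen–Sarti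
Prop. 2.5: "`(β_*π^*x)(β_*π^*y) = 2xy`", intersection numbers, `p₁ = [pt_X]`, `p₁' = [pt_Y]`),
then it holds through EVERY pair of integral markings `(φ₀, p)`, `(η₀, p')` — the binder shape of
clause (g) of the fact. [cite: VanGeemenSarti2007, Prop. 2.5] [cite: Huybrechts2016K3, Ch. 1 §3.3] -/
theorem VanGeemenSarti2007_nikulinQuotient.double_cup_of_one_marking
    (N : Fin 8 → complexBetti Y (2 * 1)) (G : complexBetti Y (2 * 1) →ₗ[ℂ] complexBetti X (2 * 1))
    (φ₁ : complexBetti X (2 * 1) ≃ₗ[ℂ] (K3Index → ℂ)) (p₁ : complexBetti X (2 * 2))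
    (η₁ : complexBetti Y (2 * 1) ≃ₗ[ℂ] (K3Index → ℂ)) (p₁' : complexBetti Y (2 * 2))
    (hφ₁ : ∀ c : complexBetti X (2 * 1), IsIntegralClass c ↔ ∃ v : K3Index → ℤ, φ₁ c = fun i => (v i : ℂ))
    (hp₁ : ∀ a b : complexBetti X (2 * 1),
      cupProduct (rfl : 2 * 1 + 2 * 1 = 2 * 2) a b = k3Form (φ₁ a) (φ₁ b) • p₁)
    (hη₁ : ∀ c : complexBetti Y (2 * 1), IsIntegralClass c ↔ ∃ v : K3Index → ℤ, η₁ c = fun i => (v i : ℂ))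
    (hp₁' : ∀ a b : complexBetti Y (2 * 1),
      cupProduct (rfl : 2 * 1 + 2 * 1 = 2 * 2) a b = k3Form (η₁ a) (η₁ b) • p₁')
    (hG : ∀ (x y : complexBetti Y (2 * 1)) (a : ℂ),
      (∀ j, cupProduct (rfl : 2 * 1 + 2 * 1 = 2 * 2) x (N j) = 0) →
      (∀ j, cupProduct (rfl : 2 * 1 + 2 * 1 = 2 * 2) y (N j) = 0) →
      cupProduct (rfl : 2 * 1 + 2 * 1 = 2 * 2) x y = a • p₁' →
      cupProduct (rfl : 2 * 1 + 2 * 1 = 2 * 2) (G x) (G y) = ((2 : ℂ) * a) • p₁) :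
    ∀ (φ₀ : complexBetti X (2 * 1) ≃ₗ[ℂ] (K3Index → ℂ)) (p : complexBetti X (2 * 2))
      (η₀ : complexBetti Y (2 * 1) ≃ₗ[ℂ] (K3Index → ℂ)) (p' : complexBetti Y (2 * 2)),
      (∀ c : complexBetti X (2 * 1), IsIntegralClass c ↔ ∃ v : K3Index → ℤ, φ₀ c = fun i => (v i : ℂ)) →
      (∀ a b : complexBetti X (2 * 1),
        cupProduct (rfl : 2 * 1 + 2 * 1 = 2 * 2) a b = k3Form (φ₀ a) (φ₀ b) • p) →
      (∀ c : complexBetti Y (2 * 1), IsIntegralClass c ↔ ∃ v : K3Index → ℤ, η₀ c = fun i => (v i : ℂ)) →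
      (∀ a b : complexBetti Y (2 * 1),
        cupProduct (rfl : 2 * 1 + 2 * 1 = 2 * 2) a b = k3Form (η₀ a) (η₀ b) • p') →
      ∀ (x y : complexBetti Y (2 * 1)) (a : ℂ),
        (∀ j, cupProduct (rfl : 2 * 1 + 2 * 1 = 2 * 2) x (N j) = 0) →
        (∀ j, cupProduct (rfl : 2 * 1 + 2 * 1 = 2 * 2) y (N j) = 0) →
        cupProduct (rfl : 2 * 1 + 2 * 1 = 2 * 2) x y = a • p' →
        cupProduct (rfl : 2 * 1 + 2 * 1 = 2 * 2) (G x) (G y) = ((2 : ℂ) * a) • p := by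
  intro φ₀ p η₀ p' hφ₀ hp hη₀ hp' x y a hx hy hxy
  have hpX : p₁ = p := marking_generator_eq_of_cupProduct φ₁ φ₀ p₁ p hφ₁ hp₁ hφ₀ hp
  have hpY : p₁' = p' := marking_generator_eq_of_cupProduct η₁ η₀ p₁' p' hη₁ hp₁' hη₀ hp'
  rw [← hpX]
  exact hG x y a hx hy (hpY ▸ hxy)

end Carriers

end Literature.AlgebraicGeometry.Surfaces

end
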